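import Summits.CriticalPhenomena.Ising3DConformalLimit.Theorems.MoebiusLimitExists.Negative.RotationFromInversion
import Summits.CriticalPhenomena.Ising3DConformalLimit.Theorems.MoebiusLimitExists.Negative.ScaleRedundant
import Summits.CriticalPhenomena.Ising3DConformalLimit.Theorems.MoebiusLimitExists.Negative.FreeTranslations

/-!
# `MoebiusLimit` (item stmt-CriticalPhenomena-1344) = "a non-degenerate limit exists and is covariant under the unit inversion"

The definitive reduction of the crux `…Theses.EnergyNotSigmaSquared.MoebiusLimit`
(= `PerfectScreening.MoebiusLimitExists`), standing crux disprover (D-0016); THEOREM-ONLY: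

  `moebiusLimit_iff_inversion :
     MoebiusLimit ↔ ∃ ρ Δ S, (∀ δ ∈ (0,1], 0 < ρ δ) ∧ HasPointwiseScalingLimit (criticalCorr 3) ρ S ∧
       IsNondegenerateTwoPoint S ∧ IsInversionCovariant Δ S`

and the same for the sub-problem statement with `∧ HasNontrivialU4 S`
(`critIsing3DConformalLimit_iff_inversion`). Ingredients: translations are free for any limit
(`FreeTranslations`), dilations with some `Δ'` are automatic (`ScaleFree`/`ScaleRedundant`), the
two-point function of a limit is symmetric (`limit_two_symm`, lattice symmetry), inversion + scale
covariance force `Δ = Δ'` and a radial two-point function (`InversionRadial`), and then rotation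
invariance follows from inversion covariance through the word
`R_{m^⊥} = ι_m ι_{m/2,1/2} ι_m` (`ReflectionWord`, `RotationFromInversion`; Cartan–Dieudonné).
So of the five clauses of the crux and the four Möbius generators, exactly two things carry
content: EXISTENCE of a non-degenerate pointwise limit of the critical correlators on `ℤ³`, and its
covariance under the single map `x ↦ x/‖x‖²`.
-/

noncomputable section

namespace Summit.CriticalPhenomena.Ising3DConformalLimit.MoebiusLimitExistsNegative

open Literature.Probability.LatticeModels Filter Set
open scoped Topology

/-- The two-point function of any pointwise limit is symmetric on non-coincident pairs
(`⟨σ_aσ_b⟩ = ⟨σ_bσ_a⟩` on the lattice). [folklore] -/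
theorem limit_two_symm {ρ : ℝ → ℝ} {S : CorrFamily 3}
    (hlim : HasPointwiseScalingLimit (criticalCorr 3) ρ S) {p q : EuclideanSpace ℝ (Fin 3)}
    (hpq : p ≠ q) : S 2 ![p, q] = S 2 ![q, p] := by
  have h1 := (hlim 2).tendsto_at (pair_mem_nonCoincident hpq)
  have h2 := (hlim 2).tendsto_at (pair_mem_nonCoincident hpq.symm)
  refine tendsto_nhds_unique h1 (h2.congr fun δ => ?_)
  rw [rescaledCorrelator_apply, rescaledCorrelator_apply, latticeApprox_comp_two, latticeApprox_comp_two,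
    criticalCorr_two_pair, criticalCorr_two_pair]
  simp only [Matrix.cons_val_zero, Matrix.cons_val_one, Matrix.cons_val_fin_one]
  rw [criticalTwoPoint_sub_comm]

/-- **THE CRUX = EXISTENCE + UNIT-INVERSION COVARIANCE.** [folklore] -/
theorem moebiusLimit_iff_inversion :
    Summit.CriticalPhenomena.Ising3DConformalLimit.Theses.EnergyNotSigmaSquared.MoebiusLimit ↔
      ∃ (ρ : ℝ → ℝ) (Δ : ℝ) (S : CorrFamily 3), (∀ δ ∈ Set.Ioc (0:ℝ) 1, 0 < ρ δ) ∧
        HasPointwiseScalingLimit (criticalCorr 3) ρ S ∧ IsNondegenerateTwoPoint S ∧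
          IsInversionCovariant Δ S := by
  classical
  constructor
  · rintro ⟨ρ, Δ, S, h1, -, h3, h4, h5⟩
    exact ⟨ρ, Δ, S, h1, h3, h4, h5.2.2⟩
  · rintro ⟨ρ, Δ, S, hρ, hlim, hnd, hinv⟩
    set S' : CorrFamily 3 := fun n x => if x ∈ NonCoincident 3 n then S n x else 0 with hS'
    have hlim' : HasPointwiseScalingLimit (criticalCorr 3) ρ S' := normalised_hasLimit hlim
    have hnd' : IsNondegenerateTwoPoint S' := normalised_nondeg hnd
    have htr' : IsTranslationInvariant S' := isTranslationInvariant_normalised_of_limit hlim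
    have hinv' : IsInversionCovariant Δ S' := normalised_inversion hinv
    obtain ⟨Δ', hwin, hsc'⟩ := exists_scaleCovariant_normalised hρ hlim hnd
    have hsym' : ∀ p q : EuclideanSpace ℝ (Fin 3), p ≠ q → S' 2 ![p, q] = S' 2 ![q, p] := by
      intro p q hpq
      simp only [hS', if_pos (pair_mem_nonCoincident hpq), if_pos (pair_mem_nonCoincident hpq.symm)]
      exact limit_two_symm hlim hpq
    have hΔ : Δ = Δ' := delta_eq_of_inversion_of_scale' htr' hsc' hinv' hsym' hnd'
    subst hΔ
    have hrot' : IsRotationInvariant S' := isRotationInvariant_of_inversion htr' hsc' hinv' hsym' hnd'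
    exact ⟨ρ, Δ, S', hρ, by linarith [hwin.1], hlim', hnd', ⟨⟨htr', hrot'⟩, hsc', hinv'⟩⟩

/-- **THE SUB-PROBLEM = EXISTENCE + UNIT-INVERSION COVARIANCE + (iii).** [folklore] -/
theorem critIsing3DConformalLimit_iff_inversion :
    CritIsing3DConformalLimit ↔
      ∃ (ρ : ℝ → ℝ) (Δ : ℝ) (S : CorrFamily 3), (∀ δ ∈ Set.Ioc (0:ℝ) 1, 0 < ρ δ) ∧
        HasPointwiseScalingLimit (criticalCorr 3) ρ S ∧ IsNondegenerateTwoPoint S ∧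
          IsInversionCovariant Δ S ∧ HasNontrivialU4 S := by
  classical
  constructor
  · rintro ⟨ρ, Δ, S, h1, -, h3, h4, h5, h6⟩
    exact ⟨ρ, Δ, S, h1, h3, h4, h5.2.2, h6⟩
  · rintro ⟨ρ, Δ, S, hρ, hlim, hnd, hinv, hU⟩
    set S' : CorrFamily 3 := fun n x => if x ∈ NonCoincident 3 n then S n x else 0 with hS'
    have hlim' : HasPointwiseScalingLimit (criticalCorr 3) ρ S' := normalised_hasLimit hlim
    have hnd' : IsNondegenerateTwoPoint S' := normalised_nondeg hnd
    have htr' : IsTranslationInvariant S' := isTranslationInvariant_normalised_of_limit hlim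
    have hinv' : IsInversionCovariant Δ S' := normalised_inversion hinv
    obtain ⟨Δ', hwin, hsc'⟩ := exists_scaleCovariant_normalised hρ hlim hnd
    have hsym' : ∀ p q : EuclideanSpace ℝ (Fin 3), p ≠ q → S' 2 ![p, q] = S' 2 ![q, p] := by
      intro p q hpq
      simp only [hS', if_pos (pair_mem_nonCoincident hpq), if_pos (pair_mem_nonCoincident hpq.symm)]
      exact limit_two_symm hlim hpq
    have hΔ : Δ = Δ' := delta_eq_of_inversion_of_scale' htr' hsc' hinv' hsym' hnd'
    subst hΔ
    have hrot' : IsRotationInvariant S' := isRotationInvariant_of_inversion htr' hsc' hinv' hsym' hnd'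
    exact ⟨ρ, Δ, S', hρ, by linarith [hwin.1], hlim', hnd', ⟨⟨htr', hrot'⟩, hsc', hinv'⟩,
      hasNontrivialU4_normalised_iff.2 hU⟩

end Summit.CriticalPhenomena.Ising3DConformalLimit.MoebiusLimitExistsNegative

end
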